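import Literature.MathematicalPhysics.QuantumFieldTheory.Balaban1983to89.T3PrintedRegularMinimiser
import Literature.MathematicalPhysics.QuantumFieldTheory.Balaban1983to89.T3RegularMinimiser
import Literature.MathematicalPhysics.QuantumFieldTheory.Balaban1983to89.T3TiltDescent
import Literature.MathematicalPhysics.QuantumFieldTheory.Balaban1983to89.T3RestrictedUnitDensity
import Literature.MathematicalPhysics.QuantumFieldTheory.Balaban1983to89.T3CruxEstimates
import Literature.MathematicalPhysics.QuantumFieldTheory.Balaban1983to89.T3ThresholdSmallness
import Literature.MathematicalPhysics.QuantumFieldTheory.Balaban1983to89.T3MinimiserStabilityReduction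
import HarnessLib

/-!
# `T3InteriorExcision` — «EDGE BAND TO THE TAIL»: the interior two-run comparison text 19935ᴵ, the interior events, the sandwich, the tail, and the one-family engine
# `unitTiltTail_of_interior` (route `UnitScaleTilt`, crux `FluctuationComparisonRegPrL` stmt-QuantumFields-19935 → 19935ᴵ; OWNER RULING ym3-torus-plan g22-№3 §B + ADDENDUM 1)

PORT, VERBATIM (§0–§5 minus the one route-level implication `regPrIntL_of_regPrL`, which names the Theses decl and lives in the Theorems sibling
`Summits/…/Theorems/UnitScaleTiltFluctuationComparisonRegPrInteriorChi.lean`), of the crux-ideate sketch `Cruxes/FluctuationComparisonRegPr/Sketch_ideator2_g13.lean`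
(seat ym-cruxidea-19201-2 g13, card C8 `edge-band-to-the-tail`; sha16 cc18dbdde0c8e029; farm rc 0 · 0 sorry) into `Literature.…Balaban1983to89.T3InteriorExcision` — a
LITERATURE module (no `Summits` import) because the route's `closes` is rendered into the Theses file, which imports Literature only (ADDENDUM 1).  CREDIT: every declaration is
ideator-2 g13's; the porting seat (ym3-torus-p2 g14, OWNER GO 14:02:40Z) changed only this docstring, the namespace and the imports.

THE LEVER.  The rung leaf consumes the two-run comparison ONLY through `T3UnitScaleTilt.UnitTiltTail r w w'`, whose good events are ARBITRARY measurable sets, and King's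
four-measure lemma charges an excised event only its MASS ([King1986] (3.12)–(3.13) p.657).  So the comparison need only hold a.e. on a DEEP INTERIOR
`{V : PlaqSmall (θBal(c·b₀) ⌊K/m⌋) V}` of the window (`0 < c ≤ 1`, one constant per block size), the edge band `{¬PlaqSmall(θBal(c·b₀))} ∩ histGood(θBal b₀)` being sent to the
TAIL, whose Gibbs mass is bounded by `HistoryTailAt F γ (c·b₀) p₀ m` — crux #3 at a rescaled profile.  On the deep interior both runs' data are χ-good ([Balaban1985UV3] (47):
print's `χ_k` decouples the datum window from the history windows by [Balaban1985Variational] Thm 1's factor `B₃`), so the inner comparison alone feeds the interior text.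
§0 profile algebra (`θBal_mul`, `θBal_mul_le`, `histGood_mono_profile`); §1 THE RE-TYPED COMPARISON `BgFluctuationIntAt` / `FluctuationComparisonRegPrIntAt` / `FluctuationComparisonRegPrIntL`
(hypothesis schemas, never asserted; the densities are UNCHANGED — still `histGood(θBal b₀ p₀)`-restricted), `bgFluctuationIntAt_of_at` (full window = `c = 1`); §2 the interior events
`histGoodInt` and the density identity `resDensity_inter_preimage_ae` / `heightDensity_histGoodInt_ae` (Radon–Nikodym uniqueness); §3 interior stability + interior comparison ⇒ the
a.e. SANDWICH of the interior-restricted densities ⇒ `IsTilt` (`T3TiltDescent`); §4 the tail at the shrunken profile; §5 `unitTiltTail_of_interior` (the `K = 0` step excised by an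
EMPTY run-(K+1) event, `IsTilt.zero_right`).  Pure measure theory ∕ bookkeeping over tree objects; nothing of [Balaban1985UV3] ∕ [King1986] is asserted.

References: C. King, CMP 102 (1986) 649–677 [King1986] (Thm 3.4 (3.9)–(3.13) p.656, (3.12) p.657, Props 3.8–3.9 pp.664–665); T. Bałaban, CMP 102 (1985) 255–275 [Balaban1985UV3]
((7) p.257, (40)–(41) p.266, (47) p.267, (71) p.273); CMP 102 (1985) 277–309 [Balaban1985Variational] (Thm 1 (8) p.279).
-/

noncomputable section

open _root_.MeasureTheory _root_.Filter _root_.Topology _root_.Set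
open Literature.MathematicalPhysics.QuantumFieldTheory.Balaban1983to89
open Literature.MathematicalPhysics.QuantumFieldTheory.Balaban1983to89.T3ContinuumYM3Torus
open Literature.MathematicalPhysics.QuantumFieldTheory.Balaban1983to89.T3LevelShift
open Literature.MathematicalPhysics.QuantumFieldTheory.Balaban1983to89.T3UnitLawDensityEML (ℰp measurableE_ℰp)
open Literature.MathematicalPhysics.QuantumFieldTheory.Balaban1983to89.T3UnitScaleTilt
open Literature.MathematicalPhysics.QuantumFieldTheory.Balaban1983to89.T3RestrictedUnitDensity
open Literature.MathematicalPhysics.QuantumFieldTheory.Balaban1983to89.T3TiltDescent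
open Literature.MathematicalPhysics.QuantumFieldTheory.Balaban1983to89.T3CruxEstimates
open Literature.MathematicalPhysics.QuantumFieldTheory.Balaban1983to89.T3RegularMinimiser
open Literature.MathematicalPhysics.QuantumFieldTheory.Balaban1983to89.T3PrintedRegularMinimiser
open Literature.MathematicalPhysics.QuantumFieldTheory.Balaban1983to89.T3MinimiserStabilityReduction (θBal_pos)
open Literature.MathematicalPhysics.QuantumFieldTheory.Balaban1983to89.T3ThresholdSmallness (exists_forall_θBal_le)
open Literature.MathematicalPhysics.QuantumFieldTheory.Balaban1983to89.Missing

namespace Literature.MathematicalPhysics.QuantumFieldTheory.Balaban1983to89.T3InteriorExcision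

/-! ## §0 Profile algebra -/

/-- `θBal` is linear in `b₀` (`p(g) = b₀(1 + log g⁻¹)^{p₀}`). [cite: Balaban1985UV3, (7) p.257] -/
theorem θBal_mul (L : ℕ) (γ c b₀ p₀ : ℝ) (i : ℕ) : θBal L γ (c * b₀) p₀ i = c * θBal L γ b₀ p₀ i := by
  simp only [θBal, B10.pFun]
  ring

/-- A shrunken profile lies below the sharp one (`0 < γ ≤ 1`, `0 < b₀`, `0 ≤ c ≤ 1`). [cite: Balaban1985UV3, (7) p.257] -/
theorem θBal_mul_le {L : ℕ} (hL : 1 ≤ L) {γ b₀ c : ℝ} (hγ : 0 < γ) (hγ1 : γ ≤ 1) (hb : 0 < b₀) (hc1 : c ≤ 1) (p₀ : ℝ) (i : ℕ) :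
    θBal L γ (c * b₀) p₀ i ≤ θBal L γ b₀ p₀ i := by
  rw [θBal_mul]
  exact mul_le_of_le_one_left (θBal_pos hL hγ hγ1 hb p₀ i).le hc1

/-- The history events are monotone in the profile. [cite: Balaban1985UV3, (7) p.257] -/
theorem histGood_mono_profile (F : T3Family) {θ θ' : ℕ → ℝ} (h : ∀ i, θ i ≤ θ' i) (K n : ℕ) :
    histGood F ℰp θ K n ⊆ histGood F ℰp θ' K n := by
  intro U hU j hj p
  exact (hU j hj p).trans_le (h _)

/-! ## §1 The re-typed crux: the comparison asserted on the deep interior only -/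

section Interior

variable (F : T3Family) (γ b₀ p₀ : ℝ) (m : ℕ)
  (A₀ A₁ : (K : ℕ) → GaugeField (F.P (K / m)) 0 (Matrix.specialUnitaryGroup (Fin 2) ℂ) → ℝ) (c : ℝ)

/-- **FLUCTUATION COMPARISON ON THE DEEP INTERIOR, AWAY FROM THE COARSEST STEP** (hypothesis schema, never asserted):
`T3RegularMinimiser.BgFluctuationAt` with its a.e. clause asserted only for steps `K ≥ 1` and only at data `V` in the `c`-interior
`PlaqSmall (θBal(c·b₀) ⌊K/m⌋) V` of the window; the two restricted densities are the SAME as in the route (events `histGood(θBal b₀ p₀)`, nothing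
re-windowed).  Both excisions are paid for in the glue: the edge band by the tail at profile `c·b₀`, the step `K = 0` by an empty good event
(`IsTilt.zero_right`, mass `1` once). [cite: King1986, Prop. 3.8-3.9 pp.664-665] -/
def BgFluctuationIntAt : Prop :=
  ∃ (r κ : ℕ → ℝ), Summable r ∧ (∀ K, 0 ≤ r K) ∧
    ∀ K, 0 < K → ∀ᵐ V ∂fieldMeasure (F.P (K / m)) 0 (Matrix.specialUnitaryGroup (Fin 2) ℂ),
      PlaqSmall (θBal F.L γ (c * b₀) p₀ (K / m)) V →
        0 < heightDensity F γ (Nat.div_le_self K m) (histGood F ℰp (θBal F.L γ b₀ p₀) K (K / m)) V ∧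
        0 < heightDensity F γ ((Nat.div_le_self K m).trans (Nat.le_succ K)) (histGood F ℰp (θBal F.L γ b₀ p₀) (K + 1) (K / m)) V ∧
        |(Real.log (heightDensity F γ ((Nat.div_le_self K m).trans (Nat.le_succ K))
              (histGood F ℰp (θBal F.L γ b₀ p₀) (K + 1) (K / m)) V) + A₁ K V) -
          (Real.log (heightDensity F γ (Nat.div_le_self K m) (histGood F ℰp (θBal F.L γ b₀ p₀) K (K / m)) V) + A₀ K V) -
            κ K| ≤ r K

variable (ε₀ : ℝ)

/-- The same at print's regular backgrounds `bgRegPr`, `bgRegPr'` (the route's twin `FluctuationComparisonRegPrAt`, interior version).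
[cite: Balaban1985UV3, (41) p.266] -/
def FluctuationComparisonRegPrIntAt : Prop :=
  BgFluctuationIntAt F γ b₀ p₀ m (bgRegPr F γ m ε₀) (bgRegPr' F γ m ε₀) c

end Interior

/-- **19935ᴵ — THE PROPOSED ITEM TEXT** (quantifier prefix of `FluctuationComparisonRegPrL` verbatim, with ONE interior constant `c ∈ (0,1]` per
block size chosen together with the thresholds): for every `L` there are `c, b₁, p₁` such that for every profile above the thresholds … the
interior comparison `FluctuationComparisonRegPrIntAt F γ b₀ p₀ m ε₀ c`. [cite: King1986, Prop. 3.8-3.9 pp.664-665] -/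
def FluctuationComparisonRegPrIntL : Prop :=
  ∀ (L : ℕ), ∃ (c b₁ p₁ : ℝ), 0 < c ∧ c ≤ 1 ∧ ∀ (b₀ p₀ : ℝ), b₁ ≤ b₀ → p₁ ≤ p₀ → 0 < b₀ → 2 < p₀ →
    ∃ ε₁ : ℝ, 0 < ε₁ ∧ ∀ (ε₀ : ℝ), 0 < ε₀ → ε₀ ≤ ε₁ → ∃ m₀ : ℕ, ∀ (m : ℕ), m₀ ≤ m →
      ∃ γ₁ : ℝ, 0 < γ₁ ∧ ∀ (F : T3Family) (γ : ℝ), F.L = L → 0 < γ → γ ≤ γ₁ →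
        FluctuationComparisonRegPrIntAt F γ b₀ p₀ m c ε₀

/-- The full-window comparison is the case `c = 1`. [cite: King1986, Prop. 3.8-3.9 pp.664-665] -/
theorem bgFluctuationIntAt_of_at {F : T3Family} {γ b₀ p₀ : ℝ} {m : ℕ}
    {A₀ A₁ : (K : ℕ) → GaugeField (F.P (K / m)) 0 (Matrix.specialUnitaryGroup (Fin 2) ℂ) → ℝ}
    (h : BgFluctuationAt F γ b₀ p₀ m A₀ A₁) : BgFluctuationIntAt F γ b₀ p₀ m A₀ A₁ 1 := by
  obtain ⟨r, κ, hr, hr0, hae⟩ := h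
  refine ⟨r, κ, hr, hr0, fun K _ => ?_⟩
  filter_upwards [hae K] with V hV hs
  rw [one_mul] at hs
  exact hV hs

/-! ## §2 The interior events and the density identity -/

section Events

variable (F : T3Family)

/-- **THE INTERIOR EVENT**: Bałaban's UV-small history with profile `θ` AND the top remembered height (`K − n` averagings, the comparison
lattice) inside the smaller window `θI`. [cite: Balaban1985UV3, (7) p.257] -/
def histGoodInt (θ : ℕ → ℝ) (θI : ℝ) (K n : ℕ) : Set (GaugeField (F.P K) 0 (Matrix.specialUnitaryGroup (Fin 2) ℂ)) :=
  histGood F ℰp θ K n ∩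
    {U | PlaqSmall θI (Averaging.iter (fun i => BlockAveraging.blockAvg (P := F.P K) (j := i) ℰp) (K - n) U)}

/-- The interior event is measurable (both factors are: `measurableSet_histGood`, `measurable_iter`). [cite: Balaban1985UV3, (7) p.257] -/
theorem measurableSet_histGoodInt (θ : ℕ → ℝ) (θI : ℝ) (K n : ℕ) : MeasurableSet (histGoodInt F θ θI K n) :=
  (measurableSet_histGood F ℰp measurableE_ℰp θ K n).inter
    (T4Continuum.measurable_iter _ (F.avgMeasurable_of_measurableE ℰp measurableE_ℰp K) (K - n) (measurableSet_plaqSmall θI))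

/-- A history with a profile below `θ` whose level-`n` threshold is below `θI` lies in the interior event. [cite: Balaban1985UV3, (7) p.257] -/
theorem histGood_subset_histGoodInt {θ θ' : ℕ → ℝ} (h : ∀ i, θ' i ≤ θ i) {θI : ℝ} {K n : ℕ} (hn : n ≤ K) (hI : θ' n ≤ θI) :
    histGood F ℰp θ' K n ⊆ histGoodInt F θ θI K n := by
  intro U hU
  refine ⟨histGood_mono_profile F h K n hU, fun p => ?_⟩
  have htop := hU (K - n) (by omega)
  rw [show K - (K - n) = n by omega] at htop
  exact (htop p).trans_le hI

/-- **RESTRICTING BY AN EVENT OF THE AVERAGED FIELD MULTIPLIES THE RESTRICTED DENSITY BY ITS INDICATOR**: `ρ^{S ∩ (Ū^k)⁻¹E}_k = 1_E·ρ^S_k`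
almost everywhere (both sides satisfy the push-forward identity `integral_resDensity_mul` against every bounded measurable test function;
Radon–Nikodym uniqueness `Integrable.ae_eq_of_forall_setIntegral_eq`). [cite: Balaban1985UV3, (2) p.256 and (7) p.257] -/
theorem resDensity_inter_preimage_ae {γ : ℝ} (hγ : 0 ≤ γ) (K : ℕ)
    {S : Set (GaugeField (F.P K) 0 (Matrix.specialUnitaryGroup (Fin 2) ℂ))} (hS : MeasurableSet S) {k : ℕ} (hk : k ≤ F.m + K)
    {E : Set (GaugeField (F.P K) k (Matrix.specialUnitaryGroup (Fin 2) ℂ))} (hE : MeasurableSet E) :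
    resDensity F γ K (S ∩ {U | Averaging.iter (fun i => BlockAveraging.blockAvg (P := F.P K) (j := i) ℰp) k U ∈ E}) k
      =ᵐ[fieldMeasure (F.P K) k (Matrix.specialUnitaryGroup (Fin 2) ℂ)] E.indicator (resDensity F γ K S k) := by
  have hiter : Measurable (Averaging.iter (fun i => BlockAveraging.blockAvg (P := F.P K) (j := i) ℰp) k) :=
    T4Continuum.measurable_iter _ (F.avgMeasurable_of_measurableE ℰp measurableE_ℰp K) k
  have hT : MeasurableSet (S ∩ {U | Averaging.iter (fun i => BlockAveraging.blockAvg (P := F.P K) (j := i) ℰp) k U ∈ E}) :=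
    hS.inter (hiter hE)
  have hbdd : ∀ T : Set (GaugeField (F.P K) k (Matrix.specialUnitaryGroup (Fin 2) ℂ)),
      ∃ C : ℝ, ∀ V, |T.indicator (fun _ => (1 : ℝ)) V| ≤ C :=
    fun T => ⟨1, fun V => by by_cases hV : V ∈ T <;> simp [hV]⟩
  refine Integrable.ae_eq_of_forall_setIntegral_eq _ _ (integrable_resDensity F K hT hγ hk)
    ((integrable_resDensity F K hS hγ hk).indicator hE) fun B hB _ => ?_
  have e1 : ∫ V in B, resDensity F γ K (S ∩ {U | Averaging.iter (fun i => BlockAveraging.blockAvg (P := F.P K) (j := i) ℰp) k U ∈ E}) k V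
        ∂fieldMeasure (F.P K) k (Matrix.specialUnitaryGroup (Fin 2) ℂ) =
      ∫ V, resDensity F γ K (S ∩ {U | Averaging.iter (fun i => BlockAveraging.blockAvg (P := F.P K) (j := i) ℰp) k U ∈ E}) k V *
        B.indicator (fun _ => (1 : ℝ)) V ∂fieldMeasure (F.P K) k (Matrix.specialUnitaryGroup (Fin 2) ℂ) := by
    rw [← integral_indicator hB]
    refine integral_congr_ae (Eventually.of_forall fun V => ?_)
    by_cases hV : V ∈ B <;> simp [hV]
  have e2 : ∫ V in B, E.indicator (resDensity F γ K S k) V ∂fieldMeasure (F.P K) k (Matrix.specialUnitaryGroup (Fin 2) ℂ) =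
      ∫ V, resDensity F γ K S k V * (E ∩ B).indicator (fun _ => (1 : ℝ)) V
        ∂fieldMeasure (F.P K) k (Matrix.specialUnitaryGroup (Fin 2) ℂ) := by
    rw [← integral_indicator hB]
    refine integral_congr_ae (Eventually.of_forall fun V => ?_)
    by_cases hV : V ∈ B <;> by_cases hV' : V ∈ E <;> simp [hV, hV']
  rw [e1, e2, integral_resDensity_mul F K hT hγ hk _ (measurable_const.indicator hB) (hbdd B),
    integral_resDensity_mul F K hS hγ hk _ (measurable_const.indicator (hE.inter hB)) (hbdd _)]
  refine integral_congr_ae (Eventually.of_forall fun U => ?_)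
  by_cases hU : U ∈ S <;>
    by_cases hUE : Averaging.iter (fun i => BlockAveraging.blockAvg (P := F.P K) (j := i) ℰp) k U ∈ E <;>
      by_cases hUB : Averaging.iter (fun i => BlockAveraging.blockAvg (P := F.P K) (j := i) ℰp) k U ∈ B <;>
        simp [hU, hUE, hUB]

/-- **AT THE COMPARISON HEIGHT**: the interior-restricted density is the indicator of the interior times the route's density, almost
everywhere on the comparison lattice. [cite: Balaban1985UV3, (7) p.257 and (41) p.266] -/
theorem heightDensity_histGoodInt_ae {γ : ℝ} (hγ : 0 ≤ γ) {n K : ℕ} (hK : n ≤ K) (θ : ℕ → ℝ) (θI : ℝ) :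
    ∀ᵐ V ∂fieldMeasure (F.P n) 0 (Matrix.specialUnitaryGroup (Fin 2) ℂ),
      heightDensity F γ hK (histGoodInt F θ θI K n) V =
        {W : GaugeField (F.P n) 0 (Matrix.specialUnitaryGroup (Fin 2) ℂ) | PlaqSmall θI W}.indicator
          (heightDensity F γ hK (histGood F ℰp θ K n)) V := by
  have hE : MeasurableSet {W : GaugeField (F.P K) (K - n) (Matrix.specialUnitaryGroup (Fin 2) ℂ) | PlaqSmall θI W} :=
    measurableSet_plaqSmall θI
  have hae := resDensity_inter_preimage_ae F hγ K (measurableSet_histGood F ℰp measurableE_ℰp θ K n) (k := K - n) (by omega) hE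
  have hmp := measurePreserving_fieldShift (G := Matrix.specialUnitaryGroup (Fin 2) ℂ)
    (F.sitesPerDir_eq (m := F.m) (K := K) (j := K - n) (m' := F.m) (K' := n) (j' := 0) (by omega))
  filter_upwards [hmp.quasiMeasurePreserving.ae hae] with V hV
  have hV' : resDensity F γ K (histGoodInt F θ θI K n) (K - n)
        (fieldShift (F.sitesPerDir_eq (m := F.m) (K := K) (j := K - n) (m' := F.m) (K' := n) (j' := 0) (by omega)) V) =
      {W : GaugeField (F.P K) (K - n) (Matrix.specialUnitaryGroup (Fin 2) ℂ) | PlaqSmall θI W}.indicator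
        (resDensity F γ K (histGood F ℰp θ K n) (K - n))
        (fieldShift (F.sitesPerDir_eq (m := F.m) (K := K) (j := K - n) (m' := F.m) (K' := n) (j' := 0) (by omega)) V) := hV
  show resDensity F γ K (histGoodInt F θ θI K n) (K - n)
      (fieldShift (F.sitesPerDir_eq (m := F.m) (K := K) (j := K - n) (m' := F.m) (K' := n) (j' := 0) (by omega)) V) = _
  by_cases hs : PlaqSmall θI V
  · have hs' : fieldShift (F.sitesPerDir_eq (m := F.m) (K := K) (j := K - n) (m' := F.m) (K' := n) (j' := 0) (by omega)) V ∈
        {W : GaugeField (F.P K) (K - n) (Matrix.specialUnitaryGroup (Fin 2) ℂ) | PlaqSmall θI W} :=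
      (plaqSmall_fieldShift F _ θI V).mpr hs
    have hsV : V ∈ {W : GaugeField (F.P n) 0 (Matrix.specialUnitaryGroup (Fin 2) ℂ) | PlaqSmall θI W} := hs
    calc resDensity F γ K (histGoodInt F θ θI K n) (K - n)
          (fieldShift (F.sitesPerDir_eq (m := F.m) (K := K) (j := K - n) (m' := F.m) (K' := n) (j' := 0) (by omega)) V)
        = resDensity F γ K (histGood F ℰp θ K n) (K - n)
          (fieldShift (F.sitesPerDir_eq (m := F.m) (K := K) (j := K - n) (m' := F.m) (K' := n) (j' := 0) (by omega)) V) := by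
            rw [hV']; exact Set.indicator_of_mem hs' _
      _ = heightDensity F γ hK (histGood F ℰp θ K n) V := rfl
      _ = _ := (Set.indicator_of_mem hsV _).symm
  · have hs' : fieldShift (F.sitesPerDir_eq (m := F.m) (K := K) (j := K - n) (m' := F.m) (K' := n) (j' := 0) (by omega)) V ∉
        {W : GaugeField (F.P K) (K - n) (Matrix.specialUnitaryGroup (Fin 2) ℂ) | PlaqSmall θI W} :=
      fun h => hs ((plaqSmall_fieldShift F _ θI V).mp h)
    have hsV : V ∉ {W : GaugeField (F.P n) 0 (Matrix.specialUnitaryGroup (Fin 2) ℂ) | PlaqSmall θI W} := hs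
    calc resDensity F γ K (histGoodInt F θ θI K n) (K - n)
          (fieldShift (F.sitesPerDir_eq (m := F.m) (K := K) (j := K - n) (m' := F.m) (K' := n) (j' := 0) (by omega)) V)
        = 0 := by rw [hV']; exact Set.indicator_of_notMem hs' _
      _ = _ := (Set.indicator_of_notMem hsV _).symm

end Events

/-! ## §3 Interior stability + interior comparison ⇒ the sandwich of the interior-restricted densities ⇒ the tilt -/

section Sandwich

variable {F : T3Family} {γ b₀ p₀ c : ℝ} {m : ℕ}
  {A₀ A₁ : (K : ℕ) → GaugeField (F.P (K / m)) 0 (Matrix.specialUnitaryGroup (Fin 2) ℂ) → ℝ}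

/-- Pointwise: positive `H₀, H₁` with `|log H₁ − log H₀ − κ| ≤ r` satisfy `e^{−r}e^{κ}H₀ ≤ H₁ ≤ e^{r}e^{κ}H₀` (the tree's private helper of
`T3RegularMinimiser`, re-proved). [cite: King1986, Thm 3.4 (3.9) p.656] -/
theorem sandwich_of_log {H₀ H₁ κ r : ℝ} (h₀ : 0 < H₀) (h₁ : 0 < H₁) (h : |Real.log H₁ - Real.log H₀ - κ| ≤ r) :
    Real.exp (-r) * Real.exp κ * H₀ ≤ H₁ ∧ H₁ ≤ Real.exp r * Real.exp κ * H₀ := by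
  obtain ⟨hl, hu⟩ := abs_le.mp h
  have e : H₁ = Real.exp (Real.log H₁ - Real.log H₀) * H₀ := by
    rw [Real.exp_sub, Real.exp_log h₁, Real.exp_log h₀, div_mul_cancel₀ _ h₀.ne']
  constructor
  · rw [e, ← Real.exp_add]
    exact mul_le_mul_of_nonneg_right (Real.exp_le_exp.mpr (by linarith)) h₀.le
  · rw [e, ← Real.exp_add]
    exact mul_le_mul_of_nonneg_right (Real.exp_le_exp.mpr (by linarith)) h₀.le

/-- **THE INTERIOR SANDWICH, EVERYWHERE**: background stability on the window and the comparison on the `c`-interior give, almost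
everywhere on the comparison lattice, the two-run sandwich of the INTERIOR-restricted densities (radii `r + r'`, constants `e^{κ'−κ}`):
on the interior they are the route's densities (§2) and the log-sandwich applies; off it both vanish. [cite: King1986, Thm 3.4 (3.9) p.656] -/
theorem interiorSandwich_of_bg (hγ : 0 ≤ γ) (hcθ : ∀ i, θBal F.L γ (c * b₀) p₀ i ≤ θBal F.L γ b₀ p₀ i)
    (hst : BgStabilityAt F γ b₀ p₀ m A₀ A₁) (hfl : BgFluctuationIntAt F γ b₀ p₀ m A₀ A₁ c) :
    ∃ (r C : ℕ → ℝ), Summable r ∧ (∀ K, 0 ≤ r K) ∧ (∀ K, 0 < C K) ∧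
      ∀ K, 0 < K → ∀ᵐ V ∂fieldMeasure (F.P (K / m)) 0 (Matrix.specialUnitaryGroup (Fin 2) ℂ),
        Real.exp (-r K) * C K *
            heightDensity F γ (Nat.div_le_self K m)
              (histGoodInt F (θBal F.L γ b₀ p₀) (θBal F.L γ (c * b₀) p₀ (K / m)) K (K / m)) V ≤
          heightDensity F γ ((Nat.div_le_self K m).trans (Nat.le_succ K))
              (histGoodInt F (θBal F.L γ b₀ p₀) (θBal F.L γ (c * b₀) p₀ (K / m)) (K + 1) (K / m)) V ∧
        heightDensity F γ ((Nat.div_le_self K m).trans (Nat.le_succ K))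
              (histGoodInt F (θBal F.L γ b₀ p₀) (θBal F.L γ (c * b₀) p₀ (K / m)) (K + 1) (K / m)) V ≤
          Real.exp (r K) * C K *
            heightDensity F γ (Nat.div_le_self K m)
              (histGoodInt F (θBal F.L γ b₀ p₀) (θBal F.L γ (c * b₀) p₀ (K / m)) K (K / m)) V := by
  obtain ⟨r, κ, hr, hr0, hm⟩ := hst
  obtain ⟨r', κ', hr', hr0', hf⟩ := hfl
  refine ⟨fun K => r K + r' K, fun K => Real.exp (κ' K - κ K), hr.add hr', fun K => add_nonneg (hr0 K) (hr0' K),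
    fun K => Real.exp_pos _, fun K hK => ?_⟩
  have h0 := heightDensity_histGoodInt_ae F hγ (Nat.div_le_self K m) (θBal F.L γ b₀ p₀) (θBal F.L γ (c * b₀) p₀ (K / m))
  have h1 := heightDensity_histGoodInt_ae F hγ ((Nat.div_le_self K m).trans (Nat.le_succ K)) (θBal F.L γ b₀ p₀)
    (θBal F.L γ (c * b₀) p₀ (K / m))
  filter_upwards [hf K hK, h0, h1] with V hV hV0 hV1
  rw [hV0, hV1]
  by_cases hs : PlaqSmall (θBal F.L γ (c * b₀) p₀ (K / m)) V
  · have hmem : V ∈ {W : GaugeField (F.P (K / m)) 0 (Matrix.specialUnitaryGroup (Fin 2) ℂ) |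
        PlaqSmall (θBal F.L γ (c * b₀) p₀ (K / m)) W} := hs
    rw [Set.indicator_of_mem hmem, Set.indicator_of_mem hmem]
    obtain ⟨hp₀, hp₁, hfl⟩ := hV hs
    have hsw : PlaqSmall (θBal F.L γ b₀ p₀ (K / m)) V := fun p => (hs p).trans_le (hcθ _)
    have hmn := hm K V hsw
    have hlog : |Real.log (heightDensity F γ ((Nat.div_le_self K m).trans (Nat.le_succ K))
          (histGood F ℰp (θBal F.L γ b₀ p₀) (K + 1) (K / m)) V) -
        Real.log (heightDensity F γ (Nat.div_le_self K m) (histGood F ℰp (θBal F.L γ b₀ p₀) K (K / m)) V) -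
        (κ' K - κ K)| ≤ r K + r' K := by
      obtain ⟨a1, a2⟩ := abs_le.mp hfl
      obtain ⟨b1, b2⟩ := abs_le.mp hmn
      exact abs_le.mpr ⟨by linarith, by linarith⟩
    exact sandwich_of_log hp₀ hp₁ hlog
  · have hmem : V ∉ {W : GaugeField (F.P (K / m)) 0 (Matrix.specialUnitaryGroup (Fin 2) ℂ) |
        PlaqSmall (θBal F.L γ (c * b₀) p₀ (K / m)) W} := hs
    rw [Set.indicator_of_notMem hmem, Set.indicator_of_notMem hmem]
    simp

/-- **THE UNIT-LATTICE TILT WITH THE INTERIOR EVENTS** (the `⌊K/m⌋` free averagings cost nothing: `T3TiltDescent` by name).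
[cite: King1986, Thm 3.4 (3.9) p.656] -/
theorem unitTilt_interior_of_bg (hγ : 0 ≤ γ) (hcθ : ∀ i, θBal F.L γ (c * b₀) p₀ i ≤ θBal F.L γ b₀ p₀ i)
    (hst : BgStabilityAt F γ b₀ p₀ m A₀ A₁) (hfl : BgFluctuationIntAt F γ b₀ p₀ m A₀ A₁ c) :
    ∃ r : ℕ → ℝ, Summable r ∧ (∀ K, 0 ≤ r K) ∧ ∀ K, 0 < K → IsTilt
      (Measure.map (unitA F ℰp K) ((gibbsK F ℰp γ K).restrict
        (histGoodInt F (θBal F.L γ b₀ p₀) (θBal F.L γ (c * b₀) p₀ (K / m)) K (K / m))))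
      (Measure.map (unitA F ℰp (K + 1)) ((gibbsK F ℰp γ (K + 1)).restrict
        (histGoodInt F (θBal F.L γ b₀ p₀) (θBal F.L γ (c * b₀) p₀ (K / m)) (K + 1) (K / m))))
      (r K) := by
  obtain ⟨r, C, hr, hr0, hC, hsand⟩ := interiorSandwich_of_bg hγ hcθ hst hfl
  exact ⟨r, hr, hr0, fun K hK => isTilt_unitA_of_isTilt_descendTo F ℰp measurableE_ℰp hγ (Nat.div_le_self K m) _ _
    (isTilt_descendTo_of_sandwich_ae F hγ (Nat.div_le_self K m) (measurableSet_histGoodInt F _ _ K _)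
      (measurableSet_histGoodInt F _ _ (K + 1) _) (hr0 K) (hC K) (hsand K hK))⟩

end Sandwich

/-! ## §4 K2 for the interior events: the edge band goes to the tail at the shrunken profile -/

section Tail

variable {F : T3Family} {γ b₀ p₀ c : ℝ} {m : ℕ}

/-- **THE COMPLEMENT OF THE INTERIOR EVENT IS A LARGE-FIELD HISTORY FOR THE PROFILE `c·b₀`**: `histGood(θBal(c·b₀)) ⊆ histGoodInt`, so its
Gibbs mass is bounded by `HistoryTailAt F γ (c·b₀) p₀ m` — crux #3 at a rescaled profile. [cite: Balaban1985UV3, (71) p.273] -/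
theorem tail_histGoodInt (hγ : 0 ≤ γ) (hcθ : ∀ i, θBal F.L γ (c * b₀) p₀ i ≤ θBal F.L γ b₀ p₀ i)
    (hT : HistoryTailAt F γ (c * b₀) p₀ m) :
    ∃ w : ℕ → ℝ, Summable w ∧ ∀ K,
      (gibbsK F ℰp γ K).real (histGoodInt F (θBal F.L γ b₀ p₀) (θBal F.L γ (c * b₀) p₀ (K / m)) K (K / m))ᶜ ≤ w K ∧
      (gibbsK F ℰp γ (K + 1)).real
          (histGoodInt F (θBal F.L γ b₀ p₀) (θBal F.L γ (c * b₀) p₀ (K / m)) (K + 1) (K / m))ᶜ ≤ w K := by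
  obtain ⟨w, hw, hb⟩ := hT
  refine ⟨w, hw, fun K => ⟨?_, ?_⟩⟩
  · haveI := isProbabilityMeasure_gibbsK F ℰp hγ K
    exact (measureReal_mono (Set.compl_subset_compl.mpr
      (histGood_subset_histGoodInt F hcθ (Nat.div_le_self K m) le_rfl))).trans (hb K).1
  · haveI := isProbabilityMeasure_gibbsK F ℰp hγ (K + 1)
    exact (measureReal_mono (Set.compl_subset_compl.mpr
      (histGood_subset_histGoodInt F hcθ ((Nat.div_le_self K m).trans (Nat.le_succ K)) le_rfl))).trans (hb K).2

end Tail

/-! ## §5 One family: K1 ∧ K2 at the unit lattice with the interior events -/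

section OneFamily

variable {F : T3Family} {γ b₀ p₀ c : ℝ} {m : ℕ}
  {A₀ A₁ : (K : ℕ) → GaugeField (F.P (K / m)) 0 (Matrix.specialUnitaryGroup (Fin 2) ℂ) → ℝ}

/-- **`UnitTiltTail` FROM THE INTERIOR DATA**: stability on the window + comparison on the `c`-interior + the tail at profile `c·b₀`
(`0 < γ ≤ 1`, `0 < b₀`, `c ≤ 1`). [cite: King1986, Thm 3.4 (3.9)-(3.13) p.656] -/
theorem unitTiltTail_of_interior (hγ : 0 < γ) (hγ1 : γ ≤ 1) (hb : 0 < b₀) (hc1 : c ≤ 1)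
    (hst : BgStabilityAt F γ b₀ p₀ m A₀ A₁) (hfl : BgFluctuationIntAt F γ b₀ p₀ m A₀ A₁ c)
    (hT : HistoryTailAt F γ (c * b₀) p₀ m) :
    ∃ r w w' : ℕ → ℝ, Summable r ∧ Summable w ∧ Summable w' ∧ UnitTiltTail F ℰp γ r w w' := by
  have hcθ : ∀ i, θBal F.L γ (c * b₀) p₀ i ≤ θBal F.L γ b₀ p₀ i := fun i => θBal_mul_le F.hL.2.le hγ hγ1 hb hc1 p₀ i
  obtain ⟨r, hr, hr0, ht⟩ := unitTilt_interior_of_bg hγ.le hcθ hst hfl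
  obtain ⟨w, hw, hb'⟩ := tail_histGoodInt hγ.le hcθ hT
  -- the step `K = 0` is excised by an EMPTY run-`(K+1)` event: the tilt is trivial (`IsTilt.zero_right`), its mass `1` is paid once
  refine ⟨r, w, fun K => w K + (if K = 0 then 1 else 0), hr, hw, hw.add (hasSum_ite_eq 0 (1 : ℝ)).summable,
    fun K => histGoodInt F (θBal F.L γ b₀ p₀) (θBal F.L γ (c * b₀) p₀ (K / m)) K (K / m),
    fun K => if K = 0 then ∅ else histGoodInt F (θBal F.L γ b₀ p₀) (θBal F.L γ (c * b₀) p₀ (K / m)) (K + 1) (K / m),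
    fun K => measurableSet_histGoodInt F _ _ K _, fun K => ?_, fun K => ?_, fun K => ⟨(hb' K).1, ?_⟩⟩
  · by_cases hK : K = 0
    · simp only [hK, ↓reduceIte, MeasurableSet.empty]
    · simp only [hK, ↓reduceIte]
      exact measurableSet_histGoodInt F _ _ (K + 1) _
  · by_cases hK : K = 0
    · simp only [hK, ↓reduceIte, Measure.restrict_empty, Measure.map_zero]
      exact IsTilt.zero_right _ (hr0 0)
    · simp only [hK, ↓reduceIte]
      exact ht K (Nat.pos_of_ne_zero hK)
  · by_cases hK : K = 0
    · haveI := isProbabilityMeasure_gibbsK F ℰp hγ.le (K + 1)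
      simp only [hK, ↓reduceIte, Set.compl_empty, probReal_univ]
      exact le_add_of_nonneg_left ((measureReal_nonneg).trans (hb' 0).1)
    · simp only [hK, ↓reduceIte, add_zero]
      exact (hb' K).2

end OneFamily

end Literature.MathematicalPhysics.QuantumFieldTheory.Balaban1983to89.T3InteriorExcision

end
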